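import Summits.KontsevichZagierPeriods.KontsevichZagierPeriods.Theorems.RootDecompRelativeModAbsoluteCylLogSplitP07

/-! # `RootDecompRelativeModAbsoluteCylLogSplitP08` — part 8/25 of the mechanical ≤330-line split of `CylLogSplit.lean`
(split by the decomp-kz census seat for landing; mathematics unchanged; part 8 continues part 7). -/

noncomputable section
open Set MeasureTheory Filter Topology
open scoped BigOperators
open Literature.NumberTheory.Transcendental Literature.ModelTheory.ExponentialFields

namespace Summit.KontsevichZagierPeriods.RootDecompRelativeModAbsolute.Rung30571

namespace RegularisedLogLayer

namespace CylLog
variable {b : ℕ}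

/-- **The NEW leaf, decided.** -/
def RegTorusProductBands : Prop :=
  RegTorusProductPosStatement ∧ RegTorusProductMixed₁Statement ∧ RegTorusProductMixed₂Statement ∧
    RegTorusProductNegStatement ∧ RegTorusProductMixed₃Statement ∧ RegTorusProductMixed₄Statement

/-- Auxiliary step `regTorusProductBands_holds`. [bookkeeping] -/
theorem regTorusProductBands_holds : RegTorusProductBands :=
  ⟨@regTorusProductPos, @regTorusProductMixed₁, @regTorusProductMixed₂, @regTorusProductNeg,
    @regTorusProductMixed₃, @regTorusProductMixed₄⟩

/-! ### §3h Two glue lemmas (NODE-g10 §D): order raising (D2) and cylinder → regularised cell (D3, `κ > 0`) — PROVED -/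

/-- **Order raising (glue D2).** On any band `[p, q]` (`p > 0`) with coefficient `c`:
`[band, c(t−1)^{M+1}/t] + [band, c(t−1)^M/t] − [G, c((q−1)^{M+1} − (p−1)^{M+1})/(M+1)] ∈ KZ.relations`
(rules 1b + 3: `(t−1)^{M+1}/t + (t−1)^M/t = (t−1)^M` is a polynomial band).  Both orientations
(`p = 1, q = v` and `p = v, q = 1`) are instances. -/
theorem regOrder_raise {b M : ℕ} {G : Set (Fin b → ℝ)} {c p q : (Fin b → ℝ) → ℝ}
    (hc : IsSemialgebraicFunOn ℚ G c) (hp : IsSemialgebraicFunOn ℚ G p)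
    (hq : IsSemialgebraicFunOn ℚ G q) (hp0 : ∀ x ∈ G, 0 < p x) (hpq : ∀ x ∈ G, p x ≤ q x)
    (P Q : KZ.IntegralRep (b + 1)) (B₀ : KZ.IntegralRep b) (hPd : P.domain = KZlog.band G p q)
    (hPi : EqOn P.integrand
      (fun z => c (Fin.init z) * ((z (Fin.last b) - 1) ^ (M + 1) / z (Fin.last b))) P.domain)
    (hQd : Q.domain = KZlog.band G p q)
    (hQi : EqOn Q.integrand
      (fun z => c (Fin.init z) * ((z (Fin.last b) - 1) ^ M / z (Fin.last b))) Q.domain)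
    (hBd : B₀.domain = G)
    (hBi : EqOn B₀.integrand
      (fun x => c x * (((q x - 1) ^ (M + 1) - (p x - 1) ^ (M + 1)) / (M + 1))) B₀.domain) :
    KZ.of P + KZ.of Q - KZ.of B₀ ∈ KZ.relations := by
  have hbpq : IsSemialgebraic ℚ (KZlog.band G p q) := KZlog.isSemialgebraic_band hp hq
  have hBm : MeasurableSet (KZlog.band G p q) := hbpq.measurableSet_holds
  have hband_sub : KZlog.band G p q ⊆ {z : Fin (b + 1) → ℝ | Fin.init z ∈ G} := fun z hz => hz.1
  have hcI : IsSemialgebraicFunOn ℚ (KZlog.band G p q) (fun z => c (Fin.init z)) :=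
    hc.comp_init.mono hband_sub hbpq
  have hsI : IsSemialgebraicFunOn ℚ (KZlog.band G p q) (fun z => z (Fin.last b)) :=
    isSemialgebraicFunOn_apply hbpq (Fin.last b)
  have hs1 : IsSemialgebraicFunOn ℚ (KZlog.band G p q) (fun z => z (Fin.last b) - 1) :=
    (IsSemialgebraicFunOn.sub_holds hsI (isSemialgebraicFunOn_ratCast hbpq 1)).congr
      fun z _ => by simp
  have hs0 : ∀ z ∈ KZlog.band G p q, z (Fin.last b) ≠ 0 := fun z hz =>
    ((hp0 _ hz.1).trans_le hz.2.1).ne'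
  have hPolysa : IsSemialgebraicFunOn ℚ (KZlog.band G p q)
      (fun z => c (Fin.init z) * (z (Fin.last b) - 1) ^ M) :=
    IsSemialgebraicFunOn.mul_holds hcI (isSemialgebraicFunOn_pow' hbpq hs1 M)
  have hsum : ∀ z ∈ KZlog.band G p q,
      P.integrand z + Q.integrand z = c (Fin.init z) * (z (Fin.last b) - 1) ^ M := by
    intro z hz
    rw [hPi (hPd ▸ hz), hQi (hQd ▸ hz)]
    have h0 := hs0 z hz
    field_simp
    ring
  have hPolyint : IntegrableOn (fun z : Fin (b + 1) → ℝ => c (Fin.init z) * (z (Fin.last b) - 1) ^ M)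
      (KZlog.band G p q) := by
    have h1 : IntegrableOn P.integrand (KZlog.band G p q) := by rw [← hPd]; exact P.integrableOn
    have h2 : IntegrableOn Q.integrand (KZlog.band G p q) := by rw [← hQd]; exact Q.integrableOn
    exact (h1.add h2).congr_fun hsum hBm
  let Poly : KZ.IntegralRep (b + 1) :=
    { domain := KZlog.band G p q
      integrand := fun z => c (Fin.init z) * (z (Fin.last b) - 1) ^ M
      isSemialgebraic_domain := hbpq
      isSemialgebraicFunOn_integrand := hPolysa
      integrableOn := hPolyint }
  have hadd : KZ.of Poly - KZ.of P - KZ.of Q ∈ KZ.relations :=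
    KZ.integrandAddRel_subset_relations ⟨b + 1, Poly, P, Q, hPd, hQd,
      fun z hz => by simpa [Poly] using (hsum z hz).symm, rfl⟩
  set F : (Fin (b + 1) → ℝ) → ℝ := fun z =>
    c (Fin.init z) * ((z (Fin.last b) - 1) ^ (M + 1) / (M + 1)) with hF
  have hFsa : IsSemialgebraicFunOn ℚ Poly.domain F := by
    have hk : IsSemialgebraicFunOn ℚ (KZlog.band G p q) (fun _ => ((M : ℝ) + 1)⁻¹) :=
      (isSemialgebraicFunOn_ratCast hbpq (((M : ℚ) + 1)⁻¹)).congr fun z _ => by push_cast; ring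
    exact (IsSemialgebraicFunOn.mul_holds hcI (IsSemialgebraicFunOn.mul_holds
      (isSemialgebraicFunOn_pow' hbpq hs1 (M + 1)) hk)).congr fun z _ => by
        simp [hF, div_eq_mul_inv]
  have hNL : KZ.of Poly - KZ.of B₀ ∈ KZ.relations := by
    refine KZ.newtonLeibnizRel_subset_relations ⟨b, Poly, B₀, p, q, F, hFsa, ?_, ?_, ?_, ?_,
      ?_, ?_, ?_, rfl⟩
    · rw [hBd]; exact hp
    · rw [hBd]; exact hq
    · rw [hBd]; exact hpq
    · rw [hBd]; rfl
    · intro x _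
      have hcont : Continuous fun t : ℝ => F (Fin.snoc x t) := by
        simp only [hF, Fin.init_snoc, Fin.snoc_last]
        fun_prop
      exact hcont.continuousOn
    · intro x _ t _
      have h1 : HasDerivAt (fun s : ℝ => (s - 1) ^ (M + 1) / ((M : ℝ) + 1))
          (((M + 1 : ℕ) : ℝ) * (t - 1) ^ M * 1 / ((M : ℝ) + 1)) t :=
        (((hasDerivAt_id t).sub_const 1).pow (M + 1)).div_const _
      have h2 := h1.const_mul (c x)
      have hM : ((M : ℝ) + 1) ≠ 0 := by positivity
      have hval : c x * ((((M + 1 : ℕ) : ℝ)) * (t - 1) ^ M * 1 / ((M : ℝ) + 1)) =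
          c x * (t - 1) ^ M := by
        rw [Nat.cast_add_one, mul_one, mul_comm ((M : ℝ) + 1) ((t - 1) ^ M), mul_div_assoc,
          div_self hM, mul_one]
      rw [hval] at h2
      have hPz : Poly.integrand (Fin.snoc x t) = c x * (t - 1) ^ M := by
        simp [Poly]
      rw [hPz]
      simp only [hF, Fin.init_snoc, Fin.snoc_last]
      exact h2
    · intro x hx
      rw [hBi hx]
      simp only [hF, Fin.init_snoc, Fin.snoc_last]
      ring
  have e : KZ.of P + KZ.of Q - KZ.of B₀ = -(KZ.of Poly - KZ.of P - KZ.of Q) + (KZ.of Poly - KZ.of B₀) := by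
    abel
  rw [e]
  exact add_mem (neg_mem hadd) hNL

/-- **Cylinder → regularised cell (glue D3), `κ > 0`.**  Over an open base with `κ > 0` differentiable,
the cylinder cell `[{0≤θ≤1} over G, c θ^M/(1+θκ)]` and the regularised cell
`[{1≤t≤1+κ}, (c/κ^{M+1})(t−1)^M/t]` differ by a relation (rule 2, `t = 1 + κθ`). -/
theorem cyl_sub_reg_mem_relations {b M : ℕ} {G : Set (Fin b → ℝ)} {c κ : (Fin b → ℝ) → ℝ}
    (hGo : IsOpen G) (hG : IsSemialgebraic ℚ G) (hκ : IsSemialgebraicFunOn ℚ G κ)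
    (hκd : DifferentiableOn ℝ κ G) (hκ0 : ∀ x ∈ G, 0 < κ x)
    (Cy Rg : KZ.IntegralRep (b + 1)) (hCd : Cy.domain = KZlog.band G (fun _ => 0) (fun _ => 1))
    (hCi : EqOn Cy.integrand (fun z => c (Fin.init z) *
      (z (Fin.last b) ^ M / (1 + z (Fin.last b) * κ (Fin.init z)))) Cy.domain)
    (hRd : Rg.domain = KZlog.band G (fun _ => 1) (fun x => 1 + κ x))
    (hRi : EqOn Rg.integrand (fun z => c (Fin.init z) / κ (Fin.init z) ^ (M + 1) *
      ((z (Fin.last b) - 1) ^ M / z (Fin.last b))) Rg.domain) :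
    KZ.of Cy - KZ.of Rg ∈ KZ.relations := by
  refine KZ.of_sub_of_mem_relations_of_affine hGo (α := fun _ => 1) (β := κ)
    (by simpa using isSemialgebraicFunOn_ratCast hG 1) hκ (differentiableOn_const _) hκd hκ0 Cy Rg
    hCd hRd (fun y _ => by ring) (fun y _ => by ring) fun z hz => ?_
  have hz' : z ∈ KZlog.band G (fun _ => 0) (fun _ => 1) := hCd ▸ hz
  obtain ⟨hx, h0, h1⟩ := hz'
  have hk : 0 < κ (Fin.init z) := hκ0 _ hx
  have hpos : 0 < 1 + κ (Fin.init z) * z (Fin.last b) := by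
    have : 0 ≤ κ (Fin.init z) * z (Fin.last b) := mul_nonneg hk.le h0
    linarith
  have hmem : (Fin.snoc (Fin.init z) (1 + κ (Fin.init z) * z (Fin.last b)) : Fin (b + 1) → ℝ) ∈
      Rg.domain := by
    rw [hRd, KZlog.snoc_mem_band]
    refine ⟨hx, ?_, ?_⟩
    · simpa using mul_nonneg hk.le h0
    · simpa using mul_le_of_le_one_right hk.le h1
  rw [hCi hz, hRi hmem]
  simp only [Fin.init_snoc, Fin.snoc_last, add_sub_cancel_left]
  have hk0 : κ (Fin.init z) ≠ 0 := hk.ne'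
  have hp0 : 1 + z (Fin.last b) * κ (Fin.init z) ≠ 0 := by rw [mul_comm]; exact hpos.ne'
  have hp0' : 1 + κ (Fin.init z) * z (Fin.last b) ≠ 0 := hpos.ne'
  field_simp
  ring

/-! ### §3i Orientation-REVERSING affine substitution (glue D3, `κ < 0`) — PROVED

The tree's `KZ.of_sub_of_mem_relations_of_affine` requires `β > 0`; Kontsevich–Zagier's rule 2 carries
`|det|`, so the decreasing case `β < 0` (edges swap: `a' = α + β b`, `b' = α + β a`, Jacobian factor `−β`)
holds by the same argument.  (Proof: the tree's, with the image computation and the sign adapted.) -/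

end CylLog
end RegularisedLogLayer
end Summit.KontsevichZagierPeriods.RootDecompRelativeModAbsolute.Rung30571
end
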